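import Summits.CriticalPhenomena.PercolationContinuityZ3.Theorems.PercNearOneGluingNoHeavyLowerTailNineTypeKernels
import Summits.CriticalPhenomena.PercolationContinuityZ3.Theorems.PercNearOneGluingNoHeavyLowerTailNineTypeTwins
import Summits.CriticalPhenomena.PercolationContinuityZ3.Theorems.PercNearOneGluingNoHeavyLowerTailQ44bRowCells

/-!
# The nine-type fibre statement as a count over monotone cell maps (interface for `Q44b ∀n`)

Support file for crux `stmt-CriticalPhenomena-4575` (master-family programme, quadratic four-point row `Q44b`),
seat `prim-l12-p6` gen 11.  Pure finite combinatorics + table facts by `decide`; no named facts, no sorries, no new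
definitions.

`TwoCopyMono.GoodKernel (kerS S)` (the fibre statement behind every all-`n` packing of the `Q44b` programme, and —
for `S = {1,…,9}` — the exact residual of `Q44b ∀n`, see `Q44b.row_nonneg_of_goodKernel`) is shown to be EQUIVALENT
to an elementary counting statement about monotone maps `ι` from the subsets of a finite type to the 15 four-point
cells (`FourPointAtoms.pat4`, ordered by `TwoCopyMono.ple` = refinement of partitions of `{a,b,c,y}`):

  `#{T : (ι T, ι Tᶜ) is the (heavy, light) pair of a type in S} ≤ #{T : ι T ∈ AC ∧ ι Tᶜ = ⊥}`

(`goodKernel_kerS_iff_cellCount`).  This is the "honest antipodal abstract model" (`prim-l12-p1` g8 §4b,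
`prim-bnk-1` g18 §0): the map `ι` carries all the information a single monotone four-point profile map has.
For whoever proves the abstract nine-type theorem (rule R7 / conjectures K1–K3, KL of `prim-bnk-1` g17–g18) we
record, as named lemmas, every hypothesis of the abstract configuration world that a monotone cell map supplies for
free: the bad points form a CONT configuration (`cellMap_cont`), no two bad points cover the ground set (COV,
`cellMap_union_ne_univ`), any two bad points intersect (INT, `cellMap_inter_nonempty`), the goods are an up-set
(`cellMap_goods_upper`) containing the HL-, HH- and LL-forced unions (`cellMap_hl_good`, `cellMap_hh_good`,
`cellMap_ll_good`) and the whole ground set (`cellMap_univ_good`), and no bad point or co-point is good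
(`cellMap_point_not_good`, `cellMap_compl_not_good`).  Consequently (`Q44b.row_nonneg_of_cellCount`):

  `Q44b ∀n`  ⟸  the cell count for `S = {1,…,9}`.
-/

namespace Summit.CriticalPhenomena.PercolationContinuityZ3.Theorems

namespace TwoCopyMono

open Finset FourPointAtoms

/-! ## Table facts over the 15 cells -/

/-- Each of the 15 partition profiles is an equivalence profile (table fact). [this work] -/
theorem isEqv_pp : ∀ i : Fin 15, IsEqv (pp i) := by
  intro i
  refine ⟨?_, ?_, ?_⟩
  · revert i; decide
  · revert i; decide
  · revert i; decide

/-- From the Boolean table order to the profile order. [this work] -/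
theorem profLE_of_ple {i j : Fin 15} (h : ple i j = true) : ProfLE (pp i) (pp j) := by
  unfold ple at h; rw [decide_eq_true_iff] at h; exact ⟨h⟩

/-- Table fact (INT): no type pair `(θ, θ')` has `heavy θ ≤ light θ'` and `heavy θ' ≤ light θ`; hence two bad points
of a monotone cell map are never disjoint. [this work] -/
theorem int_table : ∀ θ ∈ (Finset.Icc 1 9 : Finset ℕ), ∀ θ' ∈ (Finset.Icc 1 9 : Finset ℕ),
    ¬ (ple (hIdx θ) (lIdx θ') = true ∧ ple (hIdx θ') (lIdx θ) = true) := by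
  decide

/-- Table fact (COV): no type pair `(θ, θ')` has `light θ ≤ heavy θ'` and `light θ' ≤ heavy θ`; hence two bad
points of a monotone cell map never cover the ground set. [this work] -/
theorem cov_table : ∀ θ ∈ (Finset.Icc 1 9 : Finset ℕ), ∀ θ' ∈ (Finset.Icc 1 9 : Finset ℕ),
    ¬ (ple (lIdx θ) (hIdx θ') = true ∧ ple (lIdx θ') (hIdx θ) = true) := by
  decide

/-- Table fact (HH, join side): for `hhOK θ θ'`, every cell above both heavy cells is an AC cell. [this work] -/
theorem hh_table_join : ∀ θ ∈ (Finset.Icc 1 9 : Finset ℕ), ∀ θ' ∈ (Finset.Icc 1 9 : Finset ℕ),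
    NineType.hhOK θ θ' = true → ∀ x : Fin 15, ple (hIdx θ) x = true → ple (hIdx θ') x = true → isAC x := by
  decide

/-- Table fact (HH, meet side): for `hhOK θ θ'`, every cell below both light cells is `⊥`. [this work] -/
theorem hh_table_meet : ∀ θ ∈ (Finset.Icc 1 9 : Finset ℕ), ∀ θ' ∈ (Finset.Icc 1 9 : Finset ℕ),
    NineType.hhOK θ θ' = true → ∀ z : Fin 15, ple z (lIdx θ) = true → ple z (lIdx θ') = true → z = 0 := by
  decide

/-- Table fact (LL): for the LL pairs `{3,9}, {4,8}, {7,8}, {7,9}` every cell above both light cells is an AC cell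
and every cell below both heavy cells is `⊥`. [this work] -/
theorem ll_table : ∀ θ ∈ (Finset.Icc 1 9 : Finset ℕ), ∀ θ' ∈ (Finset.Icc 1 9 : Finset ℕ),
    (θ, θ') ∈ ({(3,9), (9,3), (4,8), (8,4), (7,8), (8,7), (7,9), (9,7)} : Finset (ℕ × ℕ)) →
      (∀ x : Fin 15, ple (lIdx θ) x = true → ple (lIdx θ') x = true → isAC x) ∧
      (∀ z : Fin 15, ple z (hIdx θ) = true → ple z (hIdx θ') = true → z = 0) := by
  decide

/-- Table fact: a heavy cell joined with its own light cell lies in AC, and nothing but `⊥` lies below both. [this work] -/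
theorem self_table : ∀ θ ∈ (Finset.Icc 1 9 : Finset ℕ),
    (∀ x : Fin 15, ple (hIdx θ) x = true → ple (lIdx θ) x = true → isAC x) ∧
    (∀ z : Fin 15, ple z (hIdx θ) = true → ple z (lIdx θ) = true → z = 0) ∧
    lIdx θ ≠ 0 ∧ ¬ isAC (lIdx θ) := by
  decide

/-! ## Monotone cell maps: the hypotheses of the abstract world come for free -/

section CellMap

variable {γ : Type*} [Fintype γ] [DecidableEq γ] (ι : Finset γ → Fin 15)
  (hmono : ∀ A B : Finset γ, A ⊆ B → ple (ι A) (ι B) = true)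
  (𝒯 : Finset (Finset γ)) (θ : Finset γ → ℕ)
  (hθ : ∀ t ∈ 𝒯, θ t ∈ (Finset.Icc 1 9 : Finset ℕ))
  (hh : ∀ t ∈ 𝒯, hIdx (θ t) = ι t) (hl : ∀ t ∈ 𝒯, lIdx (θ t) = ι tᶜ)
  (𝔊 : Finset (Finset γ)) (h𝔊 : ∀ T, T ∈ 𝔊 ↔ isAC (ι T) ∧ ι Tᶜ = 0)

include hmono

/-- CONT: a bad point inside a bad point has a compatible type. [this work] -/
theorem cellMap_cont (hθ : ∀ t ∈ 𝒯, θ t ∈ (Finset.Icc 1 9 : Finset ℕ))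
    (hh : ∀ t ∈ 𝒯, hIdx (θ t) = ι t) (hl : ∀ t ∈ 𝒯, lIdx (θ t) = ι tᶜ) :
    ∀ s ∈ 𝒯, ∀ t ∈ 𝒯, s ⊆ t → (θ s, θ t) ∈ NineType.contPairs := by
  intro s hs t ht hst
  apply cont_table _ (hθ s hs) _ (hθ t ht)
  · rw [hh s hs, hh t ht]; exact hmono _ _ hst
  · rw [hl s hs, hl t ht]; exact hmono _ _ (Finset.compl_subset_compl.2 hst)

/-- INT: two bad points of a monotone cell map intersect. [this work] -/
theorem cellMap_inter_nonempty (hθ : ∀ t ∈ 𝒯, θ t ∈ (Finset.Icc 1 9 : Finset ℕ))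
    (hh : ∀ t ∈ 𝒯, hIdx (θ t) = ι t) (hl : ∀ t ∈ 𝒯, lIdx (θ t) = ι tᶜ) :
    ∀ s ∈ 𝒯, ∀ t ∈ 𝒯, (s ∩ t).Nonempty := by
  intro s hs t ht
  by_contra hne
  rw [Finset.not_nonempty_iff_eq_empty] at hne
  have h1 : s ⊆ tᶜ := by
    intro e he; rw [Finset.mem_compl]; intro het
    have : e ∈ s ∩ t := Finset.mem_inter.2 ⟨he, het⟩
    rw [hne] at this; exact absurd this (Finset.notMem_empty e)
  have h2 : t ⊆ sᶜ := by
    intro e he; rw [Finset.mem_compl]; intro hes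
    have : e ∈ s ∩ t := Finset.mem_inter.2 ⟨hes, he⟩
    rw [hne] at this; exact absurd this (Finset.notMem_empty e)
  apply int_table _ (hθ s hs) _ (hθ t ht)
  refine ⟨?_, ?_⟩
  · rw [hh s hs, hl t ht]; exact hmono _ _ h1
  · rw [hh t ht, hl s hs]; exact hmono _ _ h2

/-- COV: two bad points of a monotone cell map never cover the ground set. [this work] -/
theorem cellMap_union_ne_univ (hθ : ∀ t ∈ 𝒯, θ t ∈ (Finset.Icc 1 9 : Finset ℕ))
    (hh : ∀ t ∈ 𝒯, hIdx (θ t) = ι t) (hl : ∀ t ∈ 𝒯, lIdx (θ t) = ι tᶜ) :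
    ∀ s ∈ 𝒯, ∀ t ∈ 𝒯, s ∪ t ≠ Finset.univ := by
  intro s hs t ht hU
  have h1 : tᶜ ⊆ s := by
    intro e he; rw [Finset.mem_compl] at he
    have : e ∈ s ∪ t := hU ▸ Finset.mem_univ e
    rcases Finset.mem_union.1 this with h | h
    · exact h
    · exact absurd h he
  have h2 : sᶜ ⊆ t := by
    intro e he; rw [Finset.mem_compl] at he
    have : e ∈ s ∪ t := hU ▸ Finset.mem_univ e
    rcases Finset.mem_union.1 this with h | h
    · exact absurd h he
    · exact h
  apply cov_table _ (hθ s hs) _ (hθ t ht)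
  refine ⟨?_, ?_⟩
  · rw [hl s hs, hh t ht]; exact hmono _ _ h2
  · rw [hl t ht, hh s hs]; exact hmono _ _ h1

/-- The goods of a monotone cell map form an up-set. [this work] -/
theorem cellMap_goods_upper (h𝔊 : ∀ T, T ∈ 𝔊 ↔ isAC (ι T) ∧ ι Tᶜ = 0) : IsUpperSet (𝔊 : Set (Finset γ)) := by
  intro A B hAB hA
  rw [Finset.mem_coe, h𝔊] at hA ⊢
  refine ⟨ac_up_bot_down.1 _ _ hA.1 (hmono _ _ hAB), ac_up_bot_down.2 _ ?_⟩
  rw [← hA.2]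
  exact hmono _ _ (Finset.compl_subset_compl.2 hAB)

/-- HL-forced goods: `t ∪ t'ᶜ` is good when `hlOK (θ t) (θ t')`. [this work] -/
theorem cellMap_hl_good (hθ : ∀ t ∈ 𝒯, θ t ∈ (Finset.Icc 1 9 : Finset ℕ))
    (hh : ∀ t ∈ 𝒯, hIdx (θ t) = ι t) (hl : ∀ t ∈ 𝒯, lIdx (θ t) = ι tᶜ)
    (h𝔊 : ∀ T, T ∈ 𝔊 ↔ isAC (ι T) ∧ ι Tᶜ = 0) :
    ∀ t ∈ 𝒯, ∀ t' ∈ 𝒯, NineType.hlOK (θ t) (θ t') = true → t ∪ t'ᶜ ∈ 𝔊 := by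
  intro t ht t' ht' hok
  rw [h𝔊]
  refine ⟨?_, ?_⟩
  · apply hl_table_join _ (hθ t ht) _ (hθ t' ht') hok
    · rw [hh t ht]; exact hmono _ _ Finset.subset_union_left
    · rw [hl t' ht']; exact hmono _ _ Finset.subset_union_right
  · apply hl_table_meet _ (hθ t ht) _ (hθ t' ht') hok
    · rw [hl t ht]; apply hmono
      intro e he
      rw [Finset.mem_compl, Finset.mem_union, not_or] at he
      exact Finset.mem_compl.2 he.1
    · rw [hh t' ht']; apply hmono
      intro e he
      rw [Finset.mem_compl, Finset.mem_union, not_or, Finset.mem_compl, not_not] at he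
      exact he.2

/-- HH-forced goods: `t ∪ t'` is good when `hhOK (θ t) (θ t')`. [this work] -/
theorem cellMap_hh_good (hθ : ∀ t ∈ 𝒯, θ t ∈ (Finset.Icc 1 9 : Finset ℕ))
    (hh : ∀ t ∈ 𝒯, hIdx (θ t) = ι t) (hl : ∀ t ∈ 𝒯, lIdx (θ t) = ι tᶜ)
    (h𝔊 : ∀ T, T ∈ 𝔊 ↔ isAC (ι T) ∧ ι Tᶜ = 0) :
    ∀ t ∈ 𝒯, ∀ t' ∈ 𝒯, NineType.hhOK (θ t) (θ t') = true → t ∪ t' ∈ 𝔊 := by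
  intro t ht t' ht' hok
  rw [h𝔊]
  refine ⟨?_, ?_⟩
  · apply hh_table_join _ (hθ t ht) _ (hθ t' ht') hok
    · rw [hh t ht]; exact hmono _ _ Finset.subset_union_left
    · rw [hh t' ht']; exact hmono _ _ Finset.subset_union_right
  · apply hh_table_meet _ (hθ t ht) _ (hθ t' ht') hok
    · rw [hl t ht]; apply hmono
      intro e he
      rw [Finset.mem_compl, Finset.mem_union, not_or] at he
      exact Finset.mem_compl.2 he.1
    · rw [hl t' ht']; apply hmono
      intro e he
      rw [Finset.mem_compl, Finset.mem_union, not_or] at he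
      exact Finset.mem_compl.2 he.2

/-- LL-forced goods: `tᶜ ∪ t'ᶜ` is good for the LL type pairs `{3,9}, {4,8}, {7,8}, {7,9}`. [this work] -/
theorem cellMap_ll_good (hθ : ∀ t ∈ 𝒯, θ t ∈ (Finset.Icc 1 9 : Finset ℕ))
    (hh : ∀ t ∈ 𝒯, hIdx (θ t) = ι t) (hl : ∀ t ∈ 𝒯, lIdx (θ t) = ι tᶜ)
    (h𝔊 : ∀ T, T ∈ 𝔊 ↔ isAC (ι T) ∧ ι Tᶜ = 0) :
    ∀ t ∈ 𝒯, ∀ t' ∈ 𝒯,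
      (θ t, θ t') ∈ ({(3,9), (9,3), (4,8), (8,4), (7,8), (8,7), (7,9), (9,7)} : Finset (ℕ × ℕ)) →
        tᶜ ∪ t'ᶜ ∈ 𝔊 := by
  intro t ht t' ht' hp
  obtain ⟨hj, hm⟩ := ll_table _ (hθ t ht) _ (hθ t' ht') hp
  rw [h𝔊]
  refine ⟨?_, ?_⟩
  · apply hj
    · rw [hl t ht]; exact hmono _ _ Finset.subset_union_left
    · rw [hl t' ht']; exact hmono _ _ Finset.subset_union_right
  · apply hm
    · rw [hh t ht]; apply hmono
      intro e he
      rw [Finset.mem_compl, Finset.mem_union, not_or, Finset.mem_compl, not_not] at he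
      exact he.1
    · rw [hh t' ht']; apply hmono
      intro e he
      rw [Finset.mem_compl, Finset.mem_union, not_or, Finset.mem_compl, not_not, Finset.mem_compl,
        not_not] at he
      exact he.2

/-- The ground set is good as soon as there is a bad point. [this work] -/
theorem cellMap_univ_good (hθ : ∀ t ∈ 𝒯, θ t ∈ (Finset.Icc 1 9 : Finset ℕ))
    (hh : ∀ t ∈ 𝒯, hIdx (θ t) = ι t) (hl : ∀ t ∈ 𝒯, lIdx (θ t) = ι tᶜ)
    (h𝔊 : ∀ T, T ∈ 𝔊 ↔ isAC (ι T) ∧ ι Tᶜ = 0) :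
    ∀ t ∈ 𝒯, (Finset.univ : Finset γ) ∈ 𝔊 := by
  intro t ht
  obtain ⟨hj, hm, -, -⟩ := self_table _ (hθ t ht)
  rw [h𝔊]
  refine ⟨?_, ?_⟩
  · apply hj
    · rw [hh t ht]; exact hmono _ _ (Finset.subset_univ _)
    · rw [hl t ht]; exact hmono _ _ (Finset.subset_univ _)
  · apply hm
    · rw [hh t ht, Finset.compl_univ]; exact hmono _ _ (Finset.empty_subset _)
    · rw [hl t ht, Finset.compl_univ]; exact hmono _ _ (Finset.empty_subset _)

omit hmono in
/-- A bad point is never good. [this work] -/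
theorem cellMap_point_not_good (hθ : ∀ t ∈ 𝒯, θ t ∈ (Finset.Icc 1 9 : Finset ℕ))
    (hl : ∀ t ∈ 𝒯, lIdx (θ t) = ι tᶜ) (h𝔊 : ∀ T, T ∈ 𝔊 ↔ isAC (ι T) ∧ ι Tᶜ = 0) :
    ∀ t ∈ 𝒯, t ∉ 𝔊 := by
  intro t ht hg
  rw [h𝔊] at hg
  obtain ⟨-, -, hne, -⟩ := self_table _ (hθ t ht)
  exact hne ((hl t ht).trans hg.2)

omit hmono in
/-- The complement of a bad point is never good. [this work] -/
theorem cellMap_compl_not_good (hθ : ∀ t ∈ 𝒯, θ t ∈ (Finset.Icc 1 9 : Finset ℕ))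
    (hl : ∀ t ∈ 𝒯, lIdx (θ t) = ι tᶜ) (h𝔊 : ∀ T, T ∈ 𝔊 ↔ isAC (ι T) ∧ ι Tᶜ = 0) :
    ∀ t ∈ 𝒯, tᶜ ∉ 𝔊 := by
  intro t ht hg
  rw [h𝔊] at hg
  obtain ⟨-, -, -, hnac⟩ := self_table _ (hθ t ht)
  exact hnac ((hl t ht).symm ▸ hg.1)

end CellMap

/-! ## `GoodKernel (kerS S)` is the cell count -/

/-- **The fibre statement is the cell count.**  For `S ⊆ {1,…,9}`, `kerS S` is a good kernel iff for every monotone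
map `ι` from the subsets of a finite type to the 15 four-point cells, the bad points of types in `S` (read off
`(ι T, ι Tᶜ)`) are at most as many as the goods (`ι T ∈ AC`, `ι Tᶜ = ⊥`). [this work] -/
theorem goodKernel_kerS_iff_cellCount (S : Finset ℕ) :
    GoodKernel (kerS S) ↔
      ∀ (γ : Type) [Fintype γ] [DecidableEq γ] (ι : Finset γ → Fin 15),
        (∀ A B : Finset γ, A ⊆ B → ple (ι A) (ι B) = true) →
          #(Finset.univ.filter fun T => badS S (ι T) (ι Tᶜ)) ≤
            #(Finset.univ.filter fun T => isAC (ι T) ∧ ι Tᶜ = 0) := by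
  classical
  -- the antipodal count of the profile map `pp ∘ ι` is `#𝔊 − #𝒯`
  have hsum : ∀ (γ : Type) [Fintype γ] [DecidableEq γ] (ι : Finset γ → Fin 15),
      (∑ T : Finset γ, liftK (kerS S) (pp (ι T)) (pp (ι Tᶜ))) =
        (#(Finset.univ.filter fun T => isAC (ι T) ∧ ι Tᶜ = 0) : ℤ) -
          (#(Finset.univ.filter fun T => badS S (ι T) (ι Tᶜ)) : ℤ) := by
    intro γ _ _ ι
    have h1 : ∀ T : Finset γ, liftK (kerS S) (pp (ι T)) (pp (ι Tᶜ)) =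
        (if isAC (ι T) ∧ ι Tᶜ = 0 then (1 : ℤ) else 0) - (if badS S (ι T) (ι Tᶜ) then (1 : ℤ) else 0) := by
      intro T; rw [liftK_pp]; rfl
    simp_rw [h1]
    rw [Finset.sum_sub_distrib, Finset.sum_boole, Finset.sum_boole]
  constructor
  · intro hK γ _ _ ι hmono
    have hmono' : ∀ A B : Finset γ, A ⊆ B → ProfLE (pp (ι A)) (pp (ι B)) :=
      fun A B hAB => profLE_of_ple (hmono A B hAB)
    have h0 := hK.nonneg γ (fun T => pp (ι T)) hmono' (fun T => isEqv_pp (ι T))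
    have h0' : 0 ≤ ∑ T : Finset γ, liftK (kerS S) (pp (ι T)) (pp (ι Tᶜ)) := h0
    rw [hsum γ ι] at h0'
    exact_mod_cast (by linarith : (#(Finset.univ.filter fun T => badS S (ι T) (ι Tᶜ)) : ℤ) ≤
      (#(Finset.univ.filter fun T => isAC (ι T) ∧ ι Tᶜ = 0) : ℤ))
  · intro hcount
    refine ⟨fun γ _ _ P hmono heqv => ?_⟩
    have hex : ∀ T : Finset γ, ∃ i : Fin 15, P T = pp i := fun T => exists_pat_of_isEqv (heqv T)
    choose ι hι using hex
    have hle : ∀ A B : Finset γ, A ⊆ B → ple (ι A) (ι B) = true := by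
      intro A B hAB
      apply ple_of_profLE
      rw [← hι A, ← hι B]
      exact hmono A B hAB
    have hc := hcount γ ι hle
    have hP : (∑ T : Finset γ, liftK (kerS S) (P T) (P Tᶜ)) =
        ∑ T : Finset γ, liftK (kerS S) (pp (ι T)) (pp (ι Tᶜ)) := by
      refine Finset.sum_congr rfl fun T _ => ?_
      rw [hι T, hι Tᶜ]
    rw [hP, hsum γ ι]
    have : (#(Finset.univ.filter fun T => badS S (ι T) (ι Tᶜ)) : ℤ) ≤
        (#(Finset.univ.filter fun T => isAC (ι T) ∧ ι Tᶜ = 0) : ℤ) := by exact_mod_cast hc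
    linarith

/-- The type of a bad point of a cell map: existence of a type function with the right heavy and light cells.
[this work] -/
theorem exists_typeFun (S : Finset ℕ) (hS : ∀ θ ∈ S, 1 ≤ θ ∧ θ ≤ 9) {γ : Type*} [Fintype γ] [DecidableEq γ]
    (ι : Finset γ → Fin 15) (𝒯 : Finset (Finset γ)) (h𝒯 : ∀ T, T ∈ 𝒯 → badS S (ι T) (ι Tᶜ)) :
    ∃ θ : Finset γ → ℕ, (∀ t ∈ 𝒯, θ t ∈ S) ∧ (∀ t ∈ 𝒯, θ t ∈ (Finset.Icc 1 9 : Finset ℕ)) ∧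
      (∀ t ∈ 𝒯, hIdx (θ t) = ι t) ∧ (∀ t ∈ 𝒯, lIdx (θ t) = ι tᶜ) := by
  classical
  have htyp : ∀ T ∈ 𝒯, ∃ θ ∈ S, hIdx θ = ι T ∧ lIdx θ = ι Tᶜ := fun T hT => h𝒯 T hT
  choose! θf hθS hθh hθl using htyp
  exact ⟨θf, hθS, fun t ht => Finset.mem_Icc.2 (hS _ (hθS t ht)), hθh, hθl⟩

end TwoCopyMono

/-! ## `Q44b ∀n` from the cell count -/

namespace Q44b

/-- **`Q44b ∀n` from the nine-type cell count (conditional).**  If for every monotone map `ι` from the subsets of a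
finite type to the 15 four-point cells the bad points of the nine `Q44b` types are at most as many as the goods, then
`Q44b.row w a b c y ≥ 0` on every finite weighted graph.  The hypothesis may be attacked with all of
`TwoCopyMono.cellMap_cont / _inter_nonempty / _union_ne_univ / _goods_upper / _hl_good / _hh_good / _ll_good /
_univ_good` in hand. [this work] -/
theorem row_nonneg_of_cellCount
    (h : ∀ (γ : Type) [Fintype γ] [DecidableEq γ] (ι : Finset γ → Fin 15),
      (∀ A B : Finset γ, A ⊆ B → TwoCopyMono.ple (ι A) (ι B) = true) →
        (Finset.univ.filter fun T =>
            TwoCopyMono.badS (Finset.Icc 1 9 : Finset ℕ) (ι T) (ι Tᶜ)).card ≤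
          (Finset.univ.filter fun T => TwoCopyMono.isAC (ι T) ∧ ι Tᶜ = 0).card)
    {n : ℕ} (w : Sym2 (Fin n) → unitInterval) (a b c y : Fin n) : 0 ≤ row w a b c y :=
  row_nonneg_of_goodKernel w a b c y ((TwoCopyMono.goodKernel_kerS_iff_cellCount _).2 h)

end Q44b

end Summit.CriticalPhenomena.PercolationContinuityZ3.Theorems
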